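import Mathlib
import HarnessLib
import Literature.Analysis.FluidPDE.Tao2016AveragedNS.TaylorChainCertificate
import Summits.NavierStokesRegularity.NavierStokesRegularity.Theorems.TaylorModelRungThreeReadoutPackage
import Summits.NavierStokesRegularity.NavierStokesRegularity.Theorems.TaylorModelRungThreeReadoutStubDefs
import Summits.NavierStokesRegularity.NavierStokesRegularity.Theorems.TaylorModelRungThreeGDefs
import Summits.NavierStokesRegularity.NavierStokesRegularity.Theorems.TaylorModelRungThreeReadoutWindowBridge
import Summits.NavierStokesRegularity.NavierStokesRegularity.Theorems.TaylorModelRungThreeReadoutG3Base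
import Summits.NavierStokesRegularity.NavierStokesRegularity.Theorems.TaylorModelRungThreeReadoutG3Flow
import Summits.NavierStokesRegularity.NavierStokesRegularity.Theorems.TaylorModelRungThreeReadoutG3Tube
import Summits.NavierStokesRegularity.NavierStokesRegularity.Theorems.TaylorModelRungThreeReadoutG3Calc
import Summits.NavierStokesRegularity.NavierStokesRegularity.Theorems.TaylorModelRungThreeReadoutG3Lip

/-!
# Line `taylor-model` on crux K1b-DR (stmt-NavierStokesRegularity-23954) — stub G3 PROVED:
# `stub_tube : Theorems.TaylorModel.TubeLip` (κ-tube ODE clause and flow-Lipschitz segment derivatives of K1b-DR)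

The registered stub G3 of the line (owner ns-idea-2 g3; skeleton of record v4.2, sha16 `1e740af7f1414e3e`,
texts of v4.1) BY NAME over the tree definition `Theorems.TaylorModel.TubeLip` of `…TaylorModelRungThreeGDefs`
(p598382, interface `IsWindowFlow`):

  `∀ cd φ, cd.Valid → IsWindowFlow cd φ → ChainEnclosure cd φ → Crossing cd φ (tauSel cd φ) →
     KBlockTube cd φ (tauSel cd φ) ∧ KBlockLip cd φ (tauSel cd φ)`.

It is proved in the STRONGER flow-package form `TaylorModelReadout.TubeLip` (engine-1's `…ReadoutStubDefs`,
p597090: hypothesis `IsFlowPackage cd φ` = clauses F0–F5 only, no Fréchet block) and transported by the landed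
bridge `isFlowPackage_of_isWindowFlow` (`…ReadoutWindowBridge`, p598855):

* `G3.frame_transport` — the finite-difference FRAME TRANSPORT of G-PROOFPLAN §3:
  `φ(y σ, Tn v − t) − φ(y σ', Tn v − t) = Cm v ζ`, `|ζ| ≤ NCi (s'+1) · L1 s' · |σ−σ'| d · ∏_{s'<u<v} (1+κB u) · rP v`
  (entry by the `NCi` clause; one node by the two-point clause (F5c) + the parallelepiped transport clause + the
  `κB` clause); `G3.last_leg` — (F4) at the node state with radius `ρ'' ≤ κ`;
* `G3.kBlockLip_of` — K1b-DR's LIP clause for ANY crossing-time map in the last sub-step: the σ-derivative of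
  `σ ↦ φ j (z' + σ (z − z')) i k t'` EXISTS (inside the sub-step of `t`: (F4) at the base `φ(q,t)`; across nodes:
  `deriv_node` / `deriv_advance` of `…G3Lip`, the chain rule along a C¹ curve at every node state — (F4) gives
  derivatives along straight segments inside ONE majorant horizon only, and the image of a segment under the flow
  is a curve, so Lipschitz + directional differentiability at the node states is what is chained, never a
  Fréchet derivative) and is BOUNDED by `Λ j · d · ω j k` through the local Lipschitz estimate
  (`abs_le_of_hasDerivWithinAt_Icc`): no node — `L1 s' ≤ Λ`; one node — first leg + last leg,
  `L1 s' · L1 (s'+1) ≤ Λ`; at least two nodes — first leg, frame transport, last leg, product clause of `Readouts`;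
* `G3.tubeLip` — the flow-package form `TaylorModelReadout.TubeLip` (`KBlockTube` by `G3.kBlockTube_of` of
  `…G3Tube`, `KBlockLip` by `G3.kBlockLip_of`, at `τ := tauSel cd φ`);
* `TaylorModel.stub_tube` — the registered stub, by the bridge.

MODEL-lattice bookkeeping only (rung TL-M3 of the NS ladder): nothing here is a statement about the
Navier–Stokes equations, and the crux K1b-DR itself is not proved by this file (stubs S1, K, G1, G4 remain).
-/


noncomputable section

-- the sub-problem namespace repeats the summit name by design (D-0017)
set_option linter.dupNamespace false

namespace Summit.NavierStokesRegularity.NavierStokesRegularity.Theorems.TaylorModelReadout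

open Set Filter
open Literature.Analysis.FluidPDE.TaoCascade Literature.Analysis.FluidPDE.TaoCascade.TaylorChain

namespace G3

variable {cd : CertData} {j : ℕ} {φ : Flow}

/-! ### The frame transport of finite differences and the last leg -/

/-- FRAME TRANSPORT of the finite difference between two restarted flows of the segment: at node `v`
(`s' + 1 ≤ v ≤ S`) the difference is `Cm v ζ` with `|ζ| ≤ NCi(s'+1) · L1 s' · |σ−σ'| d · ∏_{s'<u<v}(1+κB u) · rP v`
(G-PROOFPLAN §3: entry, `(1 + κB)` per node). [folklore] -/
theorem frame_transport (hV : cd.Valid) (hF : IsFlowPackage cd φ) (hC : ChainEnclosure cd φ)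
    (hj : j ≤ cd.N₀) {q : Fin 4 → ℤ → ℝ} (hq : InPoly cd j q) {s' : ℕ} (hs' : s' < cd.S j) {t : ℝ}
    (h1 : cd.Tn j s' ≤ t) (h2 : t ≤ cd.Tn j (s' + 1)) {z z' : Fin 4 → ℤ → ℝ} {d : ℝ}
    (hz : cd.InBall j (z - stAt φ j q t) (cd.κ j)) (hz' : cd.InBall j (z' - stAt φ j q t) (cd.κ j))
    (hzz : cd.InBall j (z - z') d) {σ σ' : ℝ} (hσ : σ ∈ Icc (0:ℝ) 1) (hσ' : σ' ∈ Icc (0:ℝ) 1) :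
    ∀ v, s' + 1 ≤ v → v ≤ cd.S j → ∃ ζ : Fin 4 → ℤ → ℝ,
      (∀ i k, -cd.Kb ≤ k → k ≤ cd.Ka → |ζ i k| ≤
        (cd.NCi j (s' + 1) * cd.L1 j s' * (|σ - σ'| * d) * ∏ u ∈ Finset.Ico (s' + 1) v, (1 + cd.κB j u)) *
          cd.rP j v i k) ∧
      stAt φ j (z' + σ • (z - z')) (cd.Tn j v - t) - stAt φ j (z' + σ' • (z - z')) (cd.Tn j v - t) =
        cd.Cm j v ζ := by
  have hω := omega_pos hV hj
  have hd : 0 ≤ d := inBall_nonneg hV hω hzz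
  have hL1 : 0 ≤ cd.L1 j s' := le_trans (by positivity)
    ((hV.2.2.1 j hj).2.2.2.2.2.2.2 s' hs').2.2.2.2.2.2.2.1
  intro v hv
  induction v, hv using Nat.le_induction with
  | base =>
    intro hvS
    have hΔ := first_leg_sub hV hF hC hj hq hs' h1 h2 hz hz' hzz hσ hσ' (t' := cd.Tn j (s' + 1) - t)
      ⟨by linarith, le_rfl⟩
    have hws := wsupp_stAt_sub hF hj (z' + σ • (z - z')) (z' + σ' • (z - z')) (cd.Tn j (s' + 1) - t)
      (cd.Tn j (s' + 1) - t)
    refine ⟨cd.Ci j (s' + 1) (stAt φ j (z' + σ • (z - z')) (cd.Tn j (s' + 1) - t) -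
      stAt φ j (z' + σ' • (z - z')) (cd.Tn j (s' + 1) - t)), ?_, (((frame_wsupp hV hj hvS _).2.2 hws).2).symm⟩
    have hN := NCi_clause hV hj hvS
    have hc0 : 0 ≤ cd.L1 j s' * (|σ - σ'| * d) := mul_nonneg hL1 (mul_nonneg (abs_nonneg _) hd)
    have hb := linear_scale (cd := cd) (isLinearMap_Ci hV hj hvS) (a := fun _ k => 1 * cd.ω j k)
      (b := fun i k => cd.NCi j (s' + 1) * cd.rP j (s' + 1) i k)
      (fun _ k _ _ => by have := hω k; positivity) (fun ξ hξ => hN.2 ξ hξ) hc0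
      (ξ := stAt φ j (z' + σ • (z - z')) (cd.Tn j (s' + 1) - t) -
        stAt φ j (z' + σ' • (z - z')) (cd.Tn j (s' + 1) - t))
      (fun i k hk1 hk2 => by rw [one_mul]; exact hΔ i k hk1 hk2)
    intro i k hk1 hk2
    calc _ ≤ cd.L1 j s' * (|σ - σ'| * d) * (cd.NCi j (s' + 1) * cd.rP j (s' + 1) i k) := hb i k hk1 hk2
      _ = _ := by rw [Finset.Ico_self, Finset.prod_empty]; ring
  | succ v hv ih =>
    intro hvS
    have hvS' : v < cd.S j := by omega
    obtain ⟨ζ, hζ, hΔ⟩ := ih hvS'.le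
    -- abbreviations
    set c : ℝ := cd.NCi j (s' + 1) * cd.L1 j s' * (|σ - σ'| * d) *
      ∏ u ∈ Finset.Ico (s' + 1) v, (1 + cd.κB j u) with hc
    have hc0 : 0 ≤ c := mul_nonneg (mul_nonneg (mul_nonneg (NCi_clause hV hj (by omega)).1 hL1)
      (mul_nonneg (abs_nonneg _) hd))
      (Finset.prod_nonneg fun u hu => by
        have := kappaB_nonneg hV hj (s := u) (by simp [Finset.mem_Ico] at hu; omega); linarith)
    set P : Fin 4 → ℤ → ℝ := stAt φ j (z' + σ • (z - z')) (cd.Tn j v - t) with hP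
    set P' : Fin 4 → ℤ → ℝ := stAt φ j (z' + σ' • (z - z')) (cd.Tn j v - t) with hP'
    have hA := (hV.2.2.1 j hj).2.2.2.2.2.2.1 v hvS'.le
    have hB := (hV.2.2.1 j hj).2.2.2.2.2.2.2 v hvS'
    have hρOEO : cd.EO j v ≤ cd.ρO j v := hA.2.2.2.2.2.2.2.2.1
    -- the two node states lie in the ρO-box and are c(ρO − EO)-close
    have hPx := inBall_restart_node_sub_centre hV hC hj hq hs' h1 h2 (inBall_convex hz hz' hσ)
      (v := v) (by omega) hvS'.le
    have hP'x := inBall_restart_node_sub_centre hV hC hj hq hs' h1 h2 (inBall_convex hz hz' hσ')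
      (v := v) (by omega) hvS'.le
    have hpara := para_inBall hV hj hvS'.le
    have hdd : cd.InBall j (P - P') (c * (cd.ρO j v - cd.EO j v)) := by
      rw [hΔ]
      intro i k hk1 hk2
      have h := linear_scale (cd := cd) (isLinearMap_Cm hV hj hvS'.le) (a := cd.rP j v)
        (b := fun _ k => (cd.ρO j v - cd.EO j v) * cd.ω j k) (fun i k _ _ => rP_nonneg hV hj hvS'.le i k)
        (fun ξ hξ => (hpara ξ hξ).2) hc0 hζ i k hk1 hk2
      simpa only [mul_assoc] using h
    have hws : cd.Wsupp (P - P') := wsupp_stAt_sub hF hj _ _ _ _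
    -- the two-point clause (F5c) over the full sub-step v
    have hh : cd.h j v ∈ Icc 0 (cd.h j v) := ⟨(h_pos hV hj hvS').le, le_rfl⟩
    have hF5 := ((hF j hj).2.2.2.2.2 v hvS').2.2 P P' (c * (cd.ρO j v - cd.EO j v)) hPx hP'x hdd hws
      (cd.h j v) hh
    -- flow property to the next node
    have hP1 : stAt φ j (z' + σ • (z - z')) (cd.Tn j (v + 1) - t) = stAt φ j P (cd.h j v) :=
      stAt_restart_succ hV hF hC hj hq hs' h1 h2 (inBall_convex hz hz' hσ) hv hvS'
    have hP1' : stAt φ j (z' + σ' • (z - z')) (cd.Tn j (v + 1) - t) = stAt φ j P' (cd.h j v) :=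
      stAt_restart_succ hV hF hC hj hq hs' h1 h2 (inBall_convex hz hz' hσ') hv hvS'
    set D : Fin 4 → ℤ → ℝ := stAt φ j P (cd.h j v) - stAt φ j P' (cd.h j v) -
      cd.Vap j v (cd.h j v) (P - P') with hD
    have hΔ1 : stAt φ j (z' + σ • (z - z')) (cd.Tn j (v + 1) - t) -
        stAt φ j (z' + σ' • (z - z')) (cd.Tn j (v + 1) - t) = cd.Vap j v (cd.h j v) (cd.Cm j v ζ) + D := by
      rw [hP1, hP1', hD, hΔ]; abel
    have hws1 := wsupp_stAt_sub hF hj (z' + σ • (z - z')) (z' + σ' • (z - z')) (cd.Tn j (v + 1) - t)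
      (cd.Tn j (v + 1) - t)
    refine ⟨cd.Ci j (v + 1) (stAt φ j (z' + σ • (z - z')) (cd.Tn j (v + 1) - t) -
      stAt φ j (z' + σ' • (z - z')) (cd.Tn j (v + 1) - t)), ?_,
      (((frame_wsupp hV hj hvS _).2.2 hws1).2).symm⟩
    intro i k hk1 hk2
    have hCi := isLinearMap_Ci hV hj hvS
    rw [hΔ1, hCi.map_add, Pi.add_apply]
    -- first term: parallelepiped transport (clause :170) scaled by c
    have h21 : ∀ ξ : (Fin 4 → ℤ → ℝ), (∀ i k, -cd.Kb ≤ k → k ≤ cd.Ka → |ξ i k| ≤ cd.rP j v i k) →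
        ∀ i k, -cd.Kb ≤ k → k ≤ cd.Ka →
          |cd.Ci j (v + 1) (cd.Vap j v (cd.h j v) (cd.Cm j v ξ)) i k| ≤ cd.rP j (v + 1) i k :=
      hB.2.2.2.2.2.2.2.2.2.2.2.2.2.2.2.2.2.2.2.2.1
    have hCm := isLinearMap_Cm hV hj hvS'.le
    have hVap := isLinearMap_Vap hV hj hvS'.le (cd.h j v)
    have hcomp : IsLinearMap ℝ (fun ξ => cd.Ci j (v + 1) (cd.Vap j v (cd.h j v) (cd.Cm j v ξ))) :=
      ⟨fun x y => by rw [hCm.map_add, hVap.map_add, hCi.map_add],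
       fun r x => by rw [hCm.map_smul, hVap.map_smul, hCi.map_smul]⟩
    have hb1 := linear_scale (cd := cd) hcomp (a := cd.rP j v) (b := cd.rP j (v + 1))
      (fun i k _ _ => rP_nonneg hV hj hvS'.le i k) h21 hc0 hζ i k hk1 hk2
    -- second term: NCi clause scaled by the defect radius, then the κB clause
    have hKc0 : 0 ≤ (cd.RemV (cd.bb j) (cd.mC j v) (cd.h j v) +
        (1 / (1 - cd.bb j * (cd.mC j v + cd.ρO j v) * cd.h j v) ^ 2 -
          1 / (1 - cd.bb j * cd.mC j v * cd.h j v) ^ 2)) * (c * (cd.ρO j v - cd.EO j v)) :=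
      inBall_nonneg hV hω hF5
    have hN := NCi_clause hV hj hvS
    have hb2 := linear_scale (cd := cd) hCi (a := fun _ k => 1 * cd.ω j k)
      (b := fun i k => cd.NCi j (v + 1) * cd.rP j (v + 1) i k)
      (fun _ k _ _ => by have := hω k; positivity) (fun ξ hξ => hN.2 ξ hξ) hKc0 (ξ := D)
      (fun i k hk1 hk2 => by rw [one_mul]; exact hF5 i k hk1 hk2) i k hk1 hk2
    have h22 : cd.NCi j (v + 1) * (cd.RemV (cd.bb j) (cd.mC j v) (cd.h j v) +
        (1 / (1 - cd.bb j * (cd.mC j v + cd.ρO j v) * cd.h j v) ^ 2 -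
          1 / (1 - cd.bb j * cd.mC j v * cd.h j v) ^ 2)) * (cd.ρO j v - cd.EO j v) ≤ cd.κB j v :=
      hB.2.2.2.2.2.2.2.2.2.2.2.2.2.2.2.2.2.2.2.2.2.1
    have hrP := rP_nonneg hV hj hvS i k
    have hb2' : |cd.Ci j (v + 1) D i k| ≤ c * cd.κB j v * cd.rP j (v + 1) i k := by
      refine hb2.trans ?_
      calc _ = c * (cd.NCi j (v + 1) * (cd.RemV (cd.bb j) (cd.mC j v) (cd.h j v) +
            (1 / (1 - cd.bb j * (cd.mC j v + cd.ρO j v) * cd.h j v) ^ 2 -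
              1 / (1 - cd.bb j * cd.mC j v * cd.h j v) ^ 2)) * (cd.ρO j v - cd.EO j v)) *
            cd.rP j (v + 1) i k := by ring
        _ ≤ c * cd.κB j v * cd.rP j (v + 1) i k :=
            mul_le_mul_of_nonneg_right (mul_le_mul_of_nonneg_left h22 hc0) hrP
    calc _ ≤ |cd.Ci j (v + 1) (cd.Vap j v (cd.h j v) (cd.Cm j v ζ)) i k| + |cd.Ci j (v + 1) D i k| :=
          abs_add_le _ _
      _ ≤ c * cd.rP j (v + 1) i k + c * cd.κB j v * cd.rP j (v + 1) i k := add_le_add hb1 hb2'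
      _ = _ := by rw [Finset.prod_Ico_succ_top hv, hc]; ring

/-! ### The last leg -/

/-- LAST LEG: if the node states at `Tn s''` of the two restarted flows are `ρ''`-close with `ρ'' ≤ κ`, then at
any time `t + t'` of sub-step `s''` the flows are `L1 s'' · ρ''`-close (component `(i,k)`). [folklore] -/
theorem last_leg (hV : cd.Valid) (hF : IsFlowPackage cd φ) (hC : ChainEnclosure cd φ) (hj : j ≤ cd.N₀)
    {q : Fin 4 → ℤ → ℝ} (hq : InPoly cd j q) {s' : ℕ} (hs' : s' < cd.S j) {t : ℝ} (h1 : cd.Tn j s' ≤ t)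
    (h2 : t ≤ cd.Tn j (s' + 1)) {z z' : Fin 4 → ℤ → ℝ}
    (hz : cd.InBall j (z - stAt φ j q t) (cd.κ j)) (hz' : cd.InBall j (z' - stAt φ j q t) (cd.κ j))
    {s'' : ℕ} (hs1 : s' + 1 ≤ s'') (hs''S : s'' < cd.S j) {t' : ℝ} (hT1 : cd.Tn j s'' ≤ t + t')
    (hT2 : t + t' ≤ cd.Tn j (s'' + 1)) {σ σ' : ℝ} (hσ : σ ∈ Icc (0:ℝ) 1) (hσ' : σ' ∈ Icc (0:ℝ) 1)
    {ρ'' : ℝ} (hρ : cd.InBall j (stAt φ j (z' + σ • (z - z')) (cd.Tn j s'' - t) -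
      stAt φ j (z' + σ' • (z - z')) (cd.Tn j s'' - t)) ρ'') (hρκ : ρ'' ≤ cd.κ j)
    (i : Fin 4) (k : ℤ) (hk1 : -cd.Kb ≤ k) (hk2 : k ≤ cd.Ka) :
    |φ j (z' + σ • (z - z')) i k t' - φ j (z' + σ' • (z - z')) i k t'| ≤ cd.L1 j s'' * ρ'' * cd.ω j k := by
  have hω := omega_pos hV hj
  have hρ0 : 0 ≤ ρ'' := inBall_nonneg hV hω hρ
  have hTn := Tn_succ hV hj hs''S
  have hSS : cd.Tn j (s'' + 1) ≤ cd.Tn j (cd.S j) := Tn_mono hV hj (by omega) le_rfl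
  have ht'' : t + t' - cd.Tn j s'' ∈ Icc 0 (cd.h j s'') := ⟨by linarith, by linarith⟩
  -- flows through the node
  have hfl := stAt_restart_at hV hF hC hj hq hs' h1 h2 (inBall_convex hz hz' hσ) hs1 hs''S.le (T' := t')
    hT1 (hT2.trans hSS)
  have hfl' := stAt_restart_at hV hF hC hj hq hs' h1 h2 (inBall_convex hz hz' hσ') hs1 hs''S.le (T' := t')
    hT1 (hT2.trans hSS)
  -- (F4) at the base P' with radius ρ''
  have hP' := inBall_restart_node hV hC hj hq hs' h1 h2 (inBall_convex hz hz' hσ') (v := s'') (by omega)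
    hs''S
  have hm : 0 ≤ cd.mT j s'' + cd.SpO j s'' := inBall_nonneg hV hω hP'
  have hh : cd.h j s'' ∈ Icc 0 (cd.h j s'') := ⟨(h_pos hV hj hs''S).le, le_rfl⟩
  have hg := guard_of_le_h hV hj hs''S (m := cd.mT j s'' + cd.SpO j s'') (ρ := ρ'') (by linarith)
    (by linarith) hh
  have h := inBall_sub_of_F4 hF hj hm hρ0 hP' hh.1 hg hρ
    (by rw [sub_self]; exact inBall_zero hω hρ0) hρ ht'' i k hk1 hk2
  have hfac := factor_le_L1 hV hj hs''S (m := cd.mT j s'' + cd.SpO j s'') (ρ := ρ'') (by linarith)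
    (by linarith) ht''
  have e1 := congr_fun (congr_fun hfl i) k
  have e2 := congr_fun (congr_fun hfl' i) k
  simp only [stAt] at e1 e2
  simp only [Pi.sub_apply, stAt] at h
  rw [e1, e2]
  calc _ ≤ 1 / (1 - cd.bb j * (cd.mT j s'' + cd.SpO j s'' + ρ'') * (t + t' - cd.Tn j s'')) ^ 2 * ρ'' *
        cd.ω j k := h
    _ ≤ cd.L1 j s'' * ρ'' * cd.ω j k :=
        mul_le_mul_of_nonneg_right (mul_le_mul_of_nonneg_right hfac hρ0) (hω k).le

end G3

open Summit.NavierStokesRegularity.NavierStokesRegularity.Theorems.TaylorModelReadout.G3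

/-- **K1b-DR's flow-Lipschitz segment-derivative clause** for an abstract flow package with the chain enclosure
and a crossing-time map in the last sub-step: for `z, z'` in the κ-box around `φ(q,t)` at window distance `d`
and reach `t + u ≤ τ j q`, the map `σ ↦ φ j (z' + σ(z − z')) i k t'` (`t' ≤ u`) is differentiable within `[0,1]`
with derivative bounded by `Λ j · d · ω j k`. [folklore] -/
theorem G3.kBlockLip_of {cd : CertData} {φ : Flow} (hV : cd.Valid) (hF : IsFlowPackage cd φ)
    (hC : ChainEnclosure cd φ) {τ : Cross} (hX : Crossing cd φ τ) : KBlockLip cd φ τ := by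
  intro j hj q hq t ht z z' d u hzz hu htu i k hk1 hk2 t' ht'
  have hω := omega_pos hV hj
  have hκ := kappa_pos hV hj
  have hS := one_le_S hV hj
  obtain ⟨-, hτ2, -, -, -, -⟩ := hX j hj q hq
  have hz : cd.InBall j (z - stAt φ j q t) (cd.κ j) := inBall_of_tube fun i k h1 h2 => (hzz i k h1 h2).1
  have hz' : cd.InBall j (z' - stAt φ j q t) (cd.κ j) :=
    inBall_of_tube fun i k h1 h2 => (hzz i k h1 h2).2.1
  have hd : cd.InBall j (z - z') d := fun i k h1 h2 => by
    simpa only [Pi.sub_apply] using (hzz i k h1 h2).2.2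
  have hd0 : 0 ≤ d := inBall_nonneg hV hω hd
  have hΛ := (hV.2.2.2 j hj).1
  -- locate `t` in a sub-step `s'`, and `t + t'` in a sub-step `s'' ≥ s'`
  obtain ⟨s', -, hs'S, hs't, hts'⟩ := exists_substep (cd := cd) (j := j) (s₀ := 0) (by omega)
    (by rw [Tn_zero hV hj]; exact ht.1) (ht.2.trans hτ2)
  obtain ⟨s'', hs's'', hs''S, hT1, hT2⟩ := exists_substep (cd := cd) (j := j) (s₀ := s') hs'S
    (by linarith [ht'.1] : cd.Tn j s' ≤ t + t') (by linarith [ht'.2] : t + t' ≤ cd.Tn j (cd.S j))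
  have hL1 : ∀ s, s < cd.S j → 0 ≤ cd.L1 j s := fun s hs =>
    le_trans (by positivity) ((hV.2.2.1 j hj).2.2.2.2.2.2.2 s hs).2.2.2.2.2.2.2.1
  rcases Nat.eq_or_lt_of_le hs's'' with heq | hlt
  · -- no node between `t` and `t + t'`: (F4) at the base `φ(q,t)`
    subst heq
    obtain ⟨ψ, hψ⟩ := first_leg hV hF hC hj hq hs'S hs't hts' hz hz' hd (t' := t')
      ⟨ht'.1, by linarith⟩ i k hk1 hk2
    refine ⟨ψ, fun σ hσ => ⟨(hψ σ hσ).1, (hψ σ hσ).2.trans ?_⟩⟩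
    exact mul_le_mul_of_nonneg_right (mul_le_mul_of_nonneg_right (hΛ s' hs'S).1 hd0) (hω k).le
  · have hs1 : s' + 1 ≤ s'' := hlt
    have hTn'' := Tn_succ hV hj hs''S
    -- existence of the σ-derivative at every σ₀ ∈ [0,1]
    have hDE : ∀ σ₀ ∈ Icc (0:ℝ) 1, ∃ a : ℝ,
        HasDerivWithinAt (fun σ : ℝ => φ j (z' + σ • (z - z')) i k t') a (Icc 0 1) σ₀ := by
      intro σ₀ hσ₀
      have hnode := deriv_node hV hF hC hj hq hs'S hs't hts' hz hz' hd s'' hs1 hs''S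
      have hadv := deriv_advance hV hF hC hj hq hs'S hs't hts' hz hz' hs1 hs''S hnode
        (t'' := t + t' - cd.Tn j s'') ⟨by linarith, by linarith⟩ σ₀ hσ₀ i k hk1 hk2
      have e : cd.Tn j s'' - t + (t + t' - cd.Tn j s'') = t' := by ring
      rw [e] at hadv
      exact hadv
    choose! ψ hψ using hDE
    refine ⟨ψ, fun σ hσ => ⟨hψ σ hσ, ?_⟩⟩
    -- the bound, from a local Lipschitz estimate of constant Λ·d·ω
    rcases Nat.eq_or_lt_of_le hs1 with h1n | h2n
    · -- exactly one node
      subst h1n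
      set A : ℝ := cd.L1 j s' * d with hA
      have hA0 : 0 ≤ A := mul_nonneg (hL1 s' hs'S) hd0
      have hr₀ : 0 < cd.κ j / (A + 1) := div_pos hκ (by linarith)
      refine abs_le_of_hasDerivWithinAt_Icc hσ hr₀ (hψ σ hσ) fun σ₁ hσ₁ hdist => ?_
      have hρ : cd.InBall j (stAt φ j (z' + σ₁ • (z - z')) (cd.Tn j (s' + 1) - t) -
          stAt φ j (z' + σ • (z - z')) (cd.Tn j (s' + 1) - t)) (A * |σ₁ - σ|) := by
        have h := first_leg_sub hV hF hC hj hq hs'S hs't hts' hz hz' hd hσ₁ hσ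
          (t' := cd.Tn j (s' + 1) - t) ⟨by linarith, le_rfl⟩
        have e : cd.L1 j s' * (|σ₁ - σ| * d) = A * |σ₁ - σ| := by rw [hA]; ring
        rw [e] at h
        exact h
      have hρκ : A * |σ₁ - σ| ≤ cd.κ j := by
        calc A * |σ₁ - σ| ≤ A * (cd.κ j / (A + 1)) := mul_le_mul_of_nonneg_left hdist hA0
          _ ≤ cd.κ j := by
              rw [mul_div_assoc', div_le_iff₀ (by linarith)]; nlinarith [hκ.le, hA0]
      have hL := last_leg hV hF hC hj hq hs'S hs't hts' hz hz' le_rfl hs''S hT1 hT2 hσ₁ hσ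
        (ρ'' := A * |σ₁ - σ|) hρ hρκ i k hk1 hk2
      have key : cd.L1 j (s' + 1) * A ≤ cd.Λ j * d := by
        rw [hA, ← mul_assoc, mul_comm (cd.L1 j (s' + 1))]
        exact mul_le_mul_of_nonneg_right ((hΛ s' hs'S).2.1 hs''S) hd0
      calc |φ j (z' + σ₁ • (z - z')) i k t' - φ j (z' + σ • (z - z')) i k t'|
          ≤ cd.L1 j (s' + 1) * (A * |σ₁ - σ|) * cd.ω j k := hL
        _ = cd.L1 j (s' + 1) * A * cd.ω j k * |σ₁ - σ| := by ring
        _ ≤ cd.Λ j * d * cd.ω j k * |σ₁ - σ| :=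
            mul_le_mul_of_nonneg_right (mul_le_mul_of_nonneg_right key (hω k).le) (abs_nonneg _)
    · -- at least two nodes: frame transport between them
      have hA' := (hV.2.2.1 j hj).2.2.2.2.2.2.1 s'' hs''S.le
      have hρOEO : cd.EO j s'' ≤ cd.ρO j s'' := hA'.2.2.2.2.2.2.2.2.1
      have hprod : 0 ≤ ∏ u ∈ Finset.Ico (s' + 1) s'', (1 + cd.κB j u) :=
        Finset.prod_nonneg fun u hu => by
          have := kappaB_nonneg hV hj (s := u) (by simp [Finset.mem_Ico] at hu; omega); linarith
      have hN := (NCi_clause hV hj (by omega : s' + 1 ≤ cd.S j)).1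
      set A : ℝ := cd.NCi j (s' + 1) * cd.L1 j s' * d * (∏ u ∈ Finset.Ico (s' + 1) s'', (1 + cd.κB j u)) *
        (cd.ρO j s'' - cd.EO j s'') with hA
      have hA0 : 0 ≤ A :=
        mul_nonneg (mul_nonneg (mul_nonneg (mul_nonneg hN (hL1 s' hs'S)) hd0) hprod) (by linarith)
      have hr₀ : 0 < cd.κ j / (A + 1) := div_pos hκ (by linarith)
      refine abs_le_of_hasDerivWithinAt_Icc hσ hr₀ (hψ σ hσ) fun σ₁ hσ₁ hdist => ?_
      obtain ⟨ζ, hζ, hΔ⟩ := frame_transport hV hF hC hj hq hs'S hs't hts' hz hz' hd hσ₁ hσ s'' hs1 hs''S.le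
      have hc0 : 0 ≤ cd.NCi j (s' + 1) * cd.L1 j s' * (|σ₁ - σ| * d) *
          ∏ u ∈ Finset.Ico (s' + 1) s'', (1 + cd.κB j u) :=
        mul_nonneg (mul_nonneg (mul_nonneg hN (hL1 s' hs'S)) (mul_nonneg (abs_nonneg _) hd0)) hprod
      have hρ : cd.InBall j (stAt φ j (z' + σ₁ • (z - z')) (cd.Tn j s'' - t) -
          stAt φ j (z' + σ • (z - z')) (cd.Tn j s'' - t)) (A * |σ₁ - σ|) := by
        rw [hΔ]
        intro i' k' hk1' hk2'
        have h := linear_scale (cd := cd) (isLinearMap_Cm hV hj hs''S.le) (a := cd.rP j s'')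
          (b := fun _ k => (cd.ρO j s'' - cd.EO j s'') * cd.ω j k)
          (fun i k _ _ => rP_nonneg hV hj hs''S.le i k) (fun ξ hξ => (para_inBall hV hj hs''S.le ξ hξ).2)
          hc0 hζ i' k' hk1' hk2'
        calc _ ≤ _ := h
          _ = A * |σ₁ - σ| * cd.ω j k' := by rw [hA]; ring
      have hρκ : A * |σ₁ - σ| ≤ cd.κ j := by
        calc A * |σ₁ - σ| ≤ A * (cd.κ j / (A + 1)) := mul_le_mul_of_nonneg_left hdist hA0
          _ ≤ cd.κ j := by
              rw [mul_div_assoc', div_le_iff₀ (by linarith)]; nlinarith [hκ.le, hA0]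
      have hL := last_leg hV hF hC hj hq hs'S hs't hts' hz hz' hs1 hs''S hT1 hT2 hσ₁ hσ
        (ρ'' := A * |σ₁ - σ|) hρ hρκ i k hk1 hk2
      have key : cd.L1 j s'' * A ≤ cd.Λ j * d := by
        have h3 := (hΛ s' hs'S).2.2 s'' h2n hs''S
        calc cd.L1 j s'' * A = cd.L1 j s' * (cd.NCi j (s' + 1) *
              (∏ u ∈ Finset.Ico (s' + 1) s'', (1 + cd.κB j u)) * (cd.ρO j s'' - cd.EO j s'')) *
              cd.L1 j s'' * d := by rw [hA]; ring
          _ ≤ cd.Λ j * d := mul_le_mul_of_nonneg_right h3 hd0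
      calc |φ j (z' + σ₁ • (z - z')) i k t' - φ j (z' + σ • (z - z')) i k t'|
          ≤ cd.L1 j s'' * (A * |σ₁ - σ|) * cd.ω j k := hL
        _ = cd.L1 j s'' * A * cd.ω j k * |σ₁ - σ| := by ring
        _ ≤ cd.Λ j * d * cd.ω j k * |σ₁ - σ| :=
            mul_le_mul_of_nonneg_right (mul_le_mul_of_nonneg_right key (hω k).le) (abs_nonneg _)

/-- **G3 in flow-package form** (`TaylorModelReadout.TubeLip`, hypothesis `IsFlowPackage cd φ` = F0–F5 only): for a
valid certificate and an abstract flow package with the chain enclosure and the crossing facts of the selector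
`tauSel`, K1b-DR's κ-tube ODE clause and flow-Lipschitz segment-derivative clause hold. [folklore] -/
theorem G3.tubeLip : TubeLip := by
  intro cd φ hV hF hC hX
  exact ⟨kBlockTube_of hV hC hX, G3.kBlockLip_of hV hF hC hX⟩

end Summit.NavierStokesRegularity.NavierStokesRegularity.Theorems.TaylorModelReadout

namespace Summit.NavierStokesRegularity.NavierStokesRegularity.Theorems.TaylorModel

/-- **Stub G3 of line `taylor-model`, by name** (`Theorems.TaylorModel.TubeLip`, skeleton v4.2): for every valid
Taylor-chain certificate, every window flow `φ`, every chain enclosure of it and the crossing facts of `tauSel cd φ`,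
K1b-DR's κ-tube ODE clause `KBlockTube` and flow-Lipschitz segment-derivative clause `KBlockLip` hold — from the
flow-package form `TaylorModelReadout.G3.tubeLip` through the bridge `isFlowPackage_of_isWindowFlow`. [folklore] -/
theorem stub_tube : Summit.NavierStokesRegularity.NavierStokesRegularity.Theorems.TaylorModel.TubeLip :=
  fun cd φ hV hW hC hX =>
    TaylorModelReadout.G3.tubeLip cd φ hV (TaylorModelReadout.isFlowPackage_of_isWindowFlow hV hW) hC hX

end Summit.NavierStokesRegularity.NavierStokesRegularity.Theorems.TaylorModel

end
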